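/-
Copyright (c) 2026 the pub-hodgecm-mathlib formalisation cell (harness21).  Prover seat hodgecm-mathlib-A-p17 (g23), 2026-09-01.  Road «W′» = «R1LL-WILD»
((W′-B6) sub-socket (B6-V) «value laws on the torus», owner B-p14 (g33); (V-top) = this seat): THE TOP SHELLS VANISH.
-/
import Literature.NumberTheory.Rogawski1990.RankOneKappaShellConjugateDescent           -- ★ B-p14 (g33): `descent_mul`, `descent_shellConjugate_regRep` (the `hXm` shape); brings ★ p844070 (`H_v`, `fbar`'s integrand, `rhoVertexActPlace` API) + ★ p844158
import Literature.NumberTheory.Rogawski1990.LocalTransferFundamentalLemma               -- `IsLocSmooth`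
import Literature.NumberTheory.Automorphic.SLTwoTreeQuadraticTorusShellLevel            -- ★-to-be p844395 (this seat): `level_gt_of_glInt_mul_shellConj_mul_glInt` (over ★ p844376 `SLTwoTreeVertexLevel`)
import Literature.NumberTheory.Automorphic.SLTwoTreeQuadraticTorusEisenstein            -- ★ p844118 (this seat) VI: `valuation_quadNormForm_eisenstein`
import HarnessLib

/-!
# (V-top) THE TOP SHELLS VANISH: `fbar m x = 0` for `m > oT + R`, `R` the support radius of the test function
# (road «W′» = «R1LL-WILD», (W′-B6) «THE WILD LAW ON THE TORUS», sub-socket (B6-V); Labesse–Langlands 1979 §2 (2.1) p. 8)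

Topic `NumberTheory/Rogawski1990`; namespace `Literature.NumberTheory.Rogawski1990` (sibling of ★ `RankOneKappaOrbitalUnfoldingTree`, ★ `RankOneKappaShellAverageRenormalise`).
THEOREMS ONLY (no definition, no instance, no notation, no named fact, no `sorry`); kernel lane `--supports stmt-HodgeConjecture-24833`.
Cell `pub/hodgecm-mathlib` (D-0151), crux H413 = `stmt-HodgeConjecture-24833`, line «N6nsGerm», the WILDLY RAMIFIED residue; LEAD F0P3a-plan (g10) WORD T9-25; architect
A-p16 (g28) RULING A-44; (W′-B6) fold ★ p844200∕p844308 `exists_wildLaw_torus_of_shellLaws{,_of_le}` (binder `htop`); (B6-V) owner B-p14 (g33), sub-socket ledger 12:41:01Z: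
«(V-top) output: `fbar m ↑t = 0 ∧ fbar m (e ↑t) = 0` under `oT t + R < m` with YOUR `R` (`∃ R`)».  Seat A-p17 (g23) ((W′1) I–VII, tree core ★ p844376 + p844395).
HONEST LABEL: HC_CM is proved only modulo the cell's 2 remaining named inputs (hLiu418, h413) until rung 0 closes; this file is transport and asserts nothing printed.

THE MATHEMATICS [LabesseLanglands1979 §2 (2.1) p. 8; Serre1980Trees II §1.1, §1.3].  `fbar m x = ∫_{K × U(Φ₁)_v} f(k⁻¹ · (E₂⁻¹(ũ^{−m}), 1)⁻¹ x (E₂⁻¹(ũ^{−m}), 1) · k) dν(k)`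
reads the test function `f ∈ C_c^∞(H_v)` at points `Y` whose first coordinate acts on the tree of `SL₂(L⁺_v)` (through `ρ_w ∘ E₂`) by `ρ_w(E₂ k.1)⁻¹ ∘ ρ_w(S̃_m)`, `S̃_m` the
shell conjugate of `E₂ x.1`, whose projective descent is (a `GL₂(𝒪_v)`-conjugate of) `s · ι(a, b v₀ π^m; b π^{−m}, a + b u₀)` — LEVEL `2(m − oT)` from the root (★ p844395,
`oT = ord(b∕a)`), and `ρ_w(E₂ k.1)`, `k.1 ∈ K`, fixes the root, so the vertex `ρ_w(E₂ Y.1)·x₀` has level `2(m − oT)` too (★ p844376: the level is a function of the vertex and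
`GL₂(𝒪_v)`-bi-invariant).  But `f` is locally constant with compact support and `K × U(Φ₁)_v` is an open subgroup fixing `x₀`: the vertices `ρ_w(E₂ Y.1)·x₀`, `Y ∈ supp f`,
form a FINITE set — of level `≤ R` say (§2, the SUPPORT RADIUS).  Hence `f ≡ 0` on the integrand of `fbar m x` as soon as `oT + R < m` (§3), for ANY measure `ν`.
* §1 `exists_descent_place` (every `X ∈ U_w` descends; products descend to products by ★ B-p14 `descent_mul`).
* §2 **`exists_level_le_of_isLocSmooth`** — the support radius `R` of `f` (depends on `f`, `K`, `x₀` only).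
* §3 **`exists_setIntegral_shellConj_eq_zero_of_lt`** — the (V-top) head: `∃ R, ∀ m oT x …, oT + R < m → fbar m x = 0`, the shell hypothesis `hXm` in B-p14 (g33)'s
  normal form `s • ι(D · S_m(a, b) · D⁻¹)` (`D ∈ GL₂(𝒪_v)`: `D = 1` for `↑t`, `D = diag(1, u_F)` for the partner `e ↑t`, ★ A-p13 `descent_conj_diagonal_eq`), `π` ANY
  element with `|π| = |ϖ_F|` (the consumers' `ι π = η_E σ_w η_E`).

## References
* [LabesseLanglands1979] J.-P. Labesse, R. P. Langlands, *L-indistinguishability for SL(2)*, Canad. J. Math. 31 (1979): §2 (2.1) p. 8.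
* [Serre1980Trees] J.-P. Serre, *Trees* (1980): Ch. II §1.1 (distance and elementary divisors), §1.3 (stabilisers).
* [Rogawski1990] J. D. Rogawski, *Automorphic Representations of Unitary Groups in Three Variables* (1990): §4.9 p. 54.
-/

set_option autoImplicit false

noncomputable section

open MeasureTheory Topology Set Function NumberField IsDedekindDomain Matrix ValuativeRel
open scoped MatrixGroups Matrix ValuativeRel

namespace Literature.NumberTheory.Rogawski1990

open Literature.NumberTheory.Automorphic Literature.NumberTheory.Automorphic.UnitaryGroup Literature.NumberTheory.GaloisRepresentations
  Literature.NumberTheory.Automorphic.HermitianLatticeTree Literature.NumberTheory.LocalFields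

/-! ## §1 Every element of `U_w` descends -/

section Place

variable (L : Type) [Field L] [NumberField L] [IsCMField L] (v : HeightOneSpectrum (𝓞 ↥(maximalRealSubfield L)))
  (w : PlacesOver L v) (hw : IsCMField.complexConj L • w.1 = w.1)
  {α : w.1.adicCompletion L} (hα : galAdicCompletionMap (L := L) (IsCMField.complexConj L) hw α = -α) (hα0 : α ≠ 0)
  {ϖF : v.adicCompletion ↥(maximalRealSubfield L)} (hϖF : Valued.v ϖF = WithZero.exp (-1 : ℤ))

include hα hα0 in
/-- **Every `X ∈ U_w` descends**: `diag(1,α) X diag(1,α)⁻¹ = s · ι(g)` with `s ≠ 0`, `g ∈ GL₂(L⁺_v)` (★ `descent_of_mem_unitaryGroupOfForm_antidiag` through the identification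
`U(Φ₂)_w = U(σ_w, (0 1; 1 0))`). [cite: Serre1980Trees, Ch. II §1.3] -/
theorem exists_descent_place (X : ↥(unitaryGroupOfForm (galAdicCompletionMap (L := L) (IsCMField.complexConj L) hw) (placeForm (Matrix.of fun i j : Fin 2 => if i.val + j.val + 1 = 2 then (1 : L) else 0) w.1))) :
    ∃ (s : w.1.adicCompletion L) (g : GL (Fin 2) (v.adicCompletion ↥(maximalRealSubfield L))), s ≠ 0 ∧
      Matrix.diagonal ![1, α] * ((X : GL (Fin 2) (w.1.adicCompletion L)) : Matrix (Fin 2) (Fin 2) (w.1.adicCompletion L)) * Matrix.diagonal ![1, α⁻¹] = s • (g : Matrix (Fin 2) (Fin 2) (v.adicCompletion ↥(maximalRealSubfield L))).map (toPlace v w) :=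
  descent_of_mem_unitaryGroupOfForm_antidiag L v w hw hα hα0 (X : GL (Fin 2) (w.1.adicCompletion L))
    ((unitaryGroupOfForm_placeForm_antidiagTwo_eq L v w (galAdicCompletionMap (L := L) (IsCMField.complexConj L) hw)).le X.2)

/-! ## §2 The support radius of a test function -/

/-- **THE SUPPORT RADIUS.**  `K ≤ U(Φ₂)(L⁺_v)` the stabiliser of the root `x₀` through `ρ_w ∘ E₂`, `K × U(Φ₁)_v` open, `f : H_v → ℂ` locally constant with compact support.
Then there is `R : ℕ` such that for every `Y` with `f Y ≠ 0`, every descent `(s, g)` of `E₂ Y.1` and every primitive data `(c, g₀, n)` of `g` (★ p844376), `n ≤ R`: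
the vertices `ρ_w(E₂ Y.1)·x₀` met by `f` are finitely many (`Y ↦ ρ_w(E₂ Y.1)·x₀` is constant on the left cosets of the open `K × U(Φ₁)_v`, and `supp f` is compact), and the
level is a function of the vertex (★ `level_eq_of_glVertexAct_eq`). [cite: Serre1980Trees, Ch. II §1.1, §1.3] [cite: LabesseLanglands1979, §2 p. 8] -/
theorem exists_level_le_of_isLocSmooth
    (E₂ : (cmDatum L 2 (Matrix.of fun i j : Fin 2 => if i.val + j.val + 1 = 2 then (1 : L) else 0)).Local v ≃ₜ* ↥(unitaryGroupOfForm (galAdicCompletionMap (L := L) (IsCMField.complexConj L) hw) (placeForm (Matrix.of fun i j : Fin 2 => if i.val + j.val + 1 = 2 then (1 : L) else 0) w.1))) (K : Subgroup ((cmDatum L 2 (Matrix.of fun i j : Fin 2 => if i.val + j.val + 1 = 2 then (1 : L) else 0)).Local v)) (x₀ : {M : Submodule 𝒪[v.adicCompletion ↥(maximalRealSubfield L)] (Fin 2 → v.adicCompletion ↥(maximalRealSubfield L)) // IsSpecialLattice (RingHom.id _) ϖF !![(0 : v.adicCompletion ↥(maximalRealSubfield L)), 1; -1, 0] M}) (hx₀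 : x₀.1 = latt (1 : Matrix (Fin 2) (Fin 2) (v.adicCompletion ↥(maximalRealSubfield L))))
    (hK : ∀ g, g ∈ K ↔ rhoVertexActPlace L v w hw hα hα0 hϖF (E₂ g) x₀ = x₀)
    (hKo : IsOpen (((K.prod (⊤ : Subgroup ((cmDatum L 1 (Matrix.of fun i j : Fin 1 => if i.val + j.val + 1 = 1 then (1 : L) else 0)).Local v))) : Subgroup ((cmDatum L 2 (Matrix.of fun i j : Fin 2 => if i.val + j.val + 1 = 2 then (1 : L) else 0)).Local v × (cmDatum L 1 (Matrix.of fun i j : Fin 1 => if i.val + j.val + 1 = 1 then (1 : L) else 0)).Local v)) : Set ((cmDatum L 2 (Matrix.of fun i j : Fin 2 => if i.val + j.val + 1 = 2 then (1 : L) else 0)).Local v × (cmDatum L 1 (Matrix.of fun i j : Fin 1 => if i.val + j.val + 1 = 1 then (1 : L) else 0)).Local v)))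
    (f : ((cmDatum L 2 (Matrix.of fun i j : Fin 2 => if i.val + j.val + 1 = 2 then (1 : L) else 0)).Local v × (cmDatum L 1 (Matrix.of fun i j : Fin 1 => if i.val + j.val + 1 = 1 then (1 : L) else 0)).Local v) → ℂ) (hf : IsLocSmooth f) :
    ∃ R : ℕ, ∀ Y : ((cmDatum L 2 (Matrix.of fun i j : Fin 2 => if i.val + j.val + 1 = 2 then (1 : L) else 0)).Local v × (cmDatum L 1 (Matrix.of fun i j : Fin 1 => if i.val + j.val + 1 = 1 then (1 : L) else 0)).Local v), f Y ≠ 0 → ∀ {s : w.1.adicCompletion L} {g : GL (Fin 2) (v.adicCompletion ↥(maximalRealSubfield L))}, s ≠ 0 →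
      Matrix.diagonal ![1, α] * (((E₂ Y.1 : ↥(unitaryGroupOfForm (galAdicCompletionMap (L := L) (IsCMField.complexConj L) hw) (placeForm (Matrix.of fun i j : Fin 2 => if i.val + j.val + 1 = 2 then (1 : L) else 0) w.1))) : GL (Fin 2) (w.1.adicCompletion L)) : Matrix (Fin 2) (Fin 2) (w.1.adicCompletion L)) * Matrix.diagonal ![1, α⁻¹] = s • (g : Matrix (Fin 2) (Fin 2) (v.adicCompletion ↥(maximalRealSubfield L))).map (toPlace v w) →
      ∀ {c : v.adicCompletion ↥(maximalRealSubfield L)} {g₀ : Matrix (Fin 2) (Fin 2) (v.adicCompletion ↥(maximalRealSubfield L))} {n : ℕ}, c ≠ 0 → (g : Matrix (Fin 2) (Fin 2) (v.adicCompletion ↥(maximalRealSubfield L))) = c • g₀ → (∀ i j, g₀ i j ∈ 𝒪[v.adicCompletion ↥(maximalRealSubfield L)]) →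
      (∃ i j, valuation (v.adicCompletion ↥(maximalRealSubfield L)) (g₀ i j) = 1) → valuation (v.adicCompletion ↥(maximalRealSubfield L)) g₀.det = valuation (v.adicCompletion ↥(maximalRealSubfield L)) ϖF ^ n → n ≤ R := by
  haveI := isDiscreteValuationRing_integer_of_compatible hϖF
  have hϖ := isUniformizingElement_of_v_eq hϖF
  -- the vertex map `Φ Y = ρ_w(E₂ Y.1) · x₀` is right-`K × U(Φ₁)_v`-invariant, hence locally constant
  set Φ : ((cmDatum L 2 (Matrix.of fun i j : Fin 2 => if i.val + j.val + 1 = 2 then (1 : L) else 0)).Local v × (cmDatum L 1 (Matrix.of fun i j : Fin 1 => if i.val + j.val + 1 = 1 then (1 : L) else 0)).Local v) → {M : Submodule 𝒪[v.adicCompletion ↥(maximalRealSubfield L)] (Fin 2 → v.adicCompletion ↥(maximalRealSubfield L)) // IsSpecialLattice (RingHom.id _) ϖF !![(0 : v.adicCompletion ↥(maximalRealSubfield L)), 1; -1, 0] M} := fun Y => rhoVertexActPlace L v w hw hα hα0 hϖF (E₂ Y.1) x₀ with hΦdef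
  have hΦK : ∀ Y k : ((cmDatum L 2 (Matrix.of fun i j : Fin 2 => if i.val + j.val + 1 = 2 then (1 : L) else 0)).Local v × (cmDatum L 1 (Matrix.of fun i j : Fin 1 => if i.val + j.val + 1 = 1 then (1 : L) else 0)).Local v), k ∈ ((K.prod (⊤ : Subgroup ((cmDatum L 1 (Matrix.of fun i j : Fin 1 => if i.val + j.val + 1 = 1 then (1 : L) else 0)).Local v))) : Subgroup ((cmDatum L 2 (Matrix.of fun i j : Fin 2 => if i.val + j.val + 1 = 2 then (1 : L) else 0)).Local v × (cmDatum L 1 (Matrix.of fun i j : Fin 1 => if i.val + j.val + 1 = 1 then (1 : L) else 0)).Local v)) → Φ (Y * k) = Φ Y := by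
    intro Y k hk
    have hk1 : k.1 ∈ K := (Subgroup.mem_prod.1 hk).1
    simp only [hΦdef, Prod.fst_mul, map_mul, rhoVertexActPlace_mul, (hK k.1).1 hk1]
  have hopen : ∀ Y : ((cmDatum L 2 (Matrix.of fun i j : Fin 2 => if i.val + j.val + 1 = 2 then (1 : L) else 0)).Local v × (cmDatum L 1 (Matrix.of fun i j : Fin 1 => if i.val + j.val + 1 = 1 then (1 : L) else 0)).Local v), IsOpen {Y' : ((cmDatum L 2 (Matrix.of fun i j : Fin 2 => if i.val + j.val + 1 = 2 then (1 : L) else 0)).Local v × (cmDatum L 1 (Matrix.of fun i j : Fin 1 => if i.val + j.val + 1 = 1 then (1 : L) else 0)).Local v) | Φ Y' = Φ Y} := by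
    intro Y
    rw [isOpen_iff_forall_mem_open]
    intro Y₁ hY₁
    refine ⟨(fun Y' : ((cmDatum L 2 (Matrix.of fun i j : Fin 2 => if i.val + j.val + 1 = 2 then (1 : L) else 0)).Local v × (cmDatum L 1 (Matrix.of fun i j : Fin 1 => if i.val + j.val + 1 = 1 then (1 : L) else 0)).Local v) => Y₁⁻¹ * Y') ⁻¹' (((K.prod (⊤ : Subgroup ((cmDatum L 1 (Matrix.of fun i j : Fin 1 => if i.val + j.val + 1 = 1 then (1 : L) else 0)).Local v))) : Subgroup ((cmDatum L 2 (Matrix.of fun i j : Fin 2 => if i.val + j.val + 1 = 2 then (1 : L) else 0)).Local v × (cmDatum L 1 (Matrix.of fun i j : Fin 1 => if i.val + j.val + 1 = 1 then (1 : L) else 0)).Local v)) : Set ((cmDatum L 2 (Matrix.of fun i j : Fin 2 => if i.val + j.val + 1 = 2 then (1 : L) else 0)).Local v × (cmDatum L 1 (Matrix.of fun i j : Fin 1 => if i.val + j.val + 1 = 1 then (1 : L) else 0)).Local v)), fun Y' hY' => ?_,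
      hKo.preimage (continuous_const.mul continuous_id), ?_⟩
    · have h' : Φ Y' = Φ Y₁ := by rw [← mul_inv_cancel_left Y₁ Y']; exact hΦK Y₁ _ hY'
      exact h'.trans hY₁
    · show Y₁⁻¹ * Y₁ ∈ (((K.prod (⊤ : Subgroup ((cmDatum L 1 (Matrix.of fun i j : Fin 1 => if i.val + j.val + 1 = 1 then (1 : L) else 0)).Local v))) : Subgroup ((cmDatum L 2 (Matrix.of fun i j : Fin 2 => if i.val + j.val + 1 = 2 then (1 : L) else 0)).Local v × (cmDatum L 1 (Matrix.of fun i j : Fin 1 => if i.val + j.val + 1 = 1 then (1 : L) else 0)).Local v)) : Set ((cmDatum L 2 (Matrix.of fun i j : Fin 2 => if i.val + j.val + 1 = 2 then (1 : L) else 0)).Local v × (cmDatum L 1 (Matrix.of fun i j : Fin 1 => if i.val + j.val + 1 = 1 then (1 : L) else 0)).Local v))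
      rw [inv_mul_cancel]; exact Subgroup.one_mem _
  -- a finite subcover of the compact support by fibres of `Φ`
  obtain ⟨t, ht⟩ := hf.hasCompactSupport.isCompact.elim_finite_subcover (fun y : ((cmDatum L 2 (Matrix.of fun i j : Fin 2 => if i.val + j.val + 1 = 2 then (1 : L) else 0)).Local v × (cmDatum L 1 (Matrix.of fun i j : Fin 1 => if i.val + j.val + 1 = 1 then (1 : L) else 0)).Local v) => {Y' : ((cmDatum L 2 (Matrix.of fun i j : Fin 2 => if i.val + j.val + 1 = 2 then (1 : L) else 0)).Local v × (cmDatum L 1 (Matrix.of fun i j : Fin 1 => if i.val + j.val + 1 = 1 then (1 : L) else 0)).Local v) | Φ Y' = Φ y}) (fun y => hopen y)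
    (fun Y _ => Set.mem_iUnion.2 ⟨Y, rfl⟩)
  -- descents and levels at the centres
  choose sD gD hsD hD using fun Y : ((cmDatum L 2 (Matrix.of fun i j : Fin 2 => if i.val + j.val + 1 = 2 then (1 : L) else 0)).Local v × (cmDatum L 1 (Matrix.of fun i j : Fin 1 => if i.val + j.val + 1 = 1 then (1 : L) else 0)).Local v) => exists_descent_place L v w hw hα hα0 (E₂ Y.1)
  choose nL cL g0L hcL hgL hintL hprimL hdetL using fun Y : ((cmDatum L 2 (Matrix.of fun i j : Fin 2 => if i.val + j.val + 1 = 2 then (1 : L) else 0)).Local v × (cmDatum L 1 (Matrix.of fun i j : Fin 1 => if i.val + j.val + 1 = 1 then (1 : L) else 0)).Local v) => exists_level hϖ (gD Y)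
  refine ⟨t.sup nL, fun Y hY s g hs hdesc c g₀ n hc hg hint hprim hdet => ?_⟩
  have hYT : Y ∈ tsupport f := subset_tsupport _ (Function.mem_support.2 hY)
  obtain ⟨y, hy, hYy⟩ := Set.mem_iUnion₂.1 (ht hYT)
  have h1 : Φ Y = glVertexAct hϖ g x₀ := rhoVertexActPlace_eq_glVertexAct L v w hw hα hα0 hϖF (E₂ Y.1) hs hdesc x₀
  have h2 : Φ y = glVertexAct hϖ (gD y) x₀ := rhoVertexActPlace_eq_glVertexAct L v w hw hα hα0 hϖF (E₂ y.1) (hsD y) (hD y) x₀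
  have hYy' : Φ Y = Φ y := hYy
  have hn : n = nL y :=
    level_eq_of_glVertexAct_eq hϖ x₀ hx₀ (h1.symm.trans (hYy'.trans h2)) hc hg hint hprim hdet (hgL y) (hintL y) (hprimL y) (hdetL y)
  rw [hn]; exact Finset.le_sup hy

/-! ## §3 (V-top): the top shells vanish -/

/-- **(V-top) THE TOP SHELLS VANISH.**  With `R` the support radius of §2: for every shell `m`, every `x ∈ H_v` whose `m`-th shell conjugate `S̃_m = ũ^m (E₂ x.1) ũ^{−m}`
(`ũ = uη⁻¹`) descends to `s · ι(D · (a, b v₀ π^m; b π^{−m}, a + b u₀) · D⁻¹)` with `D ∈ GL₂(𝒪_v)`, `(u₀, v₀)` Eisenstein, `|π| = |ϖ_F|`, `|b∕a| = |ϖ_F|^{oT}`, and `oT + R < m`: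
`∫_{K × U(Φ₁)_v} f(k⁻¹ · ((E₂⁻¹ ũ^m, 1)⁻¹ · x · (E₂⁻¹ ũ^m, 1)) · k) dν(k) = 0` — the integrand vanishes identically (its vertex has level `2(m − oT) > R`, ★ p844395
`level_gt_of_glInt_mul_shellConj_mul_glInt`, after stripping the root-fixing `ρ_w(E₂ k.1)^{±1}` by ★ `glVertexAct_eq_self_iff`).  `ν` is ANY measure.
[cite: LabesseLanglands1979, §2 (2.1) p. 8] [cite: Serre1980Trees, Ch. II §1.1, §1.3] [cite: Rogawski1990, §4.9 p. 54] -/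
theorem exists_setIntegral_shellConj_eq_zero_of_lt [MeasurableSpace ((cmDatum L 2 (Matrix.of fun i j : Fin 2 => if i.val + j.val + 1 = 2 then (1 : L) else 0)).Local v × (cmDatum L 1 (Matrix.of fun i j : Fin 1 => if i.val + j.val + 1 = 1 then (1 : L) else 0)).Local v)] (ν : Measure ((cmDatum L 2 (Matrix.of fun i j : Fin 2 => if i.val + j.val + 1 = 2 then (1 : L) else 0)).Local v × (cmDatum L 1 (Matrix.of fun i j : Fin 1 => if i.val + j.val + 1 = 1 then (1 : L) else 0)).Local v))
    (E₂ : (cmDatum L 2 (Matrix.of fun i j : Fin 2 => if i.val + j.val + 1 = 2 then (1 : L) else 0)).Local v ≃ₜ* ↥(unitaryGroupOfForm (galAdicCompletionMap (L := L) (IsCMField.complexConj L) hw) (placeForm (Matrix.of fun i j : Fin 2 => if i.val + j.val + 1 = 2 then (1 : L) else 0) w.1))) (K : Subgroup ((cmDatum L 2 (Matrix.of fun i j : Fin 2 => if i.val + j.val + 1 = 2 then (1 : L) else 0)).Local v)) (x₀ : {M : Submodule 𝒪[v.adicCompletion ↥(maximalRealSubfield L)] (Fin 2 → v.adicCompletion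 ↥(maximalRealSubfield L)) // IsSpecialLattice (RingHom.id _) ϖF !![(0 : v.adicCompletion ↥(maximalRealSubfield L)), 1; -1, 0] M}) (hx₀ : x₀.1 = latt (1 : Matrix (Fin 2) (Fin 2) (v.adicCompletion ↥(maximalRealSubfield L))))
    (hK : ∀ g, g ∈ K ↔ rhoVertexActPlace L v w hw hα hα0 hϖF (E₂ g) x₀ = x₀)
    (hKo : IsOpen (((K.prod (⊤ : Subgroup ((cmDatum L 1 (Matrix.of fun i j : Fin 1 => if i.val + j.val + 1 = 1 then (1 : L) else 0)).Local v))) : Subgroup ((cmDatum L 2 (Matrix.of fun i j : Fin 2 => if i.val + j.val + 1 = 2 then (1 : L) else 0)).Local v × (cmDatum L 1 (Matrix.of fun i j : Fin 1 => if i.val + j.val + 1 = 1 then (1 : L) else 0)).Local v)) : Set ((cmDatum L 2 (Matrix.of fun i j : Fin 2 => if i.val + j.val + 1 = 2 then (1 : L) else 0)).Local v × (cmDatum L 1 (Matrix.of fun i j : Fin 1 => if i.val + j.val + 1 = 1 then (1 : L) else 0)).Local v)))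
    (f : ((cmDatum L 2 (Matrix.of fun i j : Fin 2 => if i.val + j.val + 1 = 2 then (1 : L) else 0)).Local v × (cmDatum L 1 (Matrix.of fun i j : Fin 1 => if i.val + j.val + 1 = 1 then (1 : L) else 0)).Local v) → ℂ) (hf : IsLocSmooth f)
    {u₀ v₀ : v.adicCompletion ↥(maximalRealSubfield L)} (hu : u₀ ∈ 𝒪[v.adicCompletion ↥(maximalRealSubfield L)]) (hu1 : valuation (v.adicCompletion ↥(maximalRealSubfield L)) u₀ < 1) (hv1 : valuation (v.adicCompletion ↥(maximalRealSubfield L)) v₀ = valuation (v.adicCompletion ↥(maximalRealSubfield L)) ϖF)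
    {π : v.adicCompletion ↥(maximalRealSubfield L)} (hπ : valuation (v.adicCompletion ↥(maximalRealSubfield L)) π = valuation (v.adicCompletion ↥(maximalRealSubfield L)) ϖF) (uη : ↥(unitaryGroupOfForm (galAdicCompletionMap (L := L) (IsCMField.complexConj L) hw) (placeForm (Matrix.of fun i j : Fin 2 => if i.val + j.val + 1 = 2 then (1 : L) else 0) w.1))) :
    ∃ R : ℕ, ∀ (m oT : ℕ) (x : ((cmDatum L 2 (Matrix.of fun i j : Fin 2 => if i.val + j.val + 1 = 2 then (1 : L) else 0)).Local v × (cmDatum L 1 (Matrix.of fun i j : Fin 1 => if i.val + j.val + 1 = 1 then (1 : L) else 0)).Local v)) {s : w.1.adicCompletion L} {a b : v.adicCompletion ↥(maximalRealSubfield L)} {D : GL (Fin 2) (v.adicCompletion ↥(maximalRealSubfield L))}, D ∈ glInt 2 (v.adicCompletion ↥(maximalRealSubfield L)) →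
      Matrix.diagonal ![1, α] * ((((uη⁻¹ ^ m)⁻¹ * E₂ x.1 * uη⁻¹ ^ m : ↥(unitaryGroupOfForm (galAdicCompletionMap (L := L) (IsCMField.complexConj L) hw) (placeForm (Matrix.of fun i j : Fin 2 => if i.val + j.val + 1 = 2 then (1 : L) else 0) w.1))) : GL (Fin 2) (w.1.adicCompletion L)) : Matrix (Fin 2) (Fin 2) (w.1.adicCompletion L)) * Matrix.diagonal ![1, α⁻¹] =
        s • ((D : Matrix (Fin 2) (Fin 2) (v.adicCompletion ↥(maximalRealSubfield L))) * !![a, b * v₀ * π ^ m; b * (π ^ m)⁻¹, a + b * u₀] * ((D⁻¹ : GL (Fin 2) (v.adicCompletion ↥(maximalRealSubfield L))) : Matrix (Fin 2) (Fin 2) (v.adicCompletion ↥(maximalRealSubfield L)))).map (toPlace v w) →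
      valuation (v.adicCompletion ↥(maximalRealSubfield L)) (b / a) = valuation (v.adicCompletion ↥(maximalRealSubfield L)) ϖF ^ oT → oT + R < m →
      ∫ k in ((((K.prod (⊤ : Subgroup ((cmDatum L 1 (Matrix.of fun i j : Fin 1 => if i.val + j.val + 1 = 1 then (1 : L) else 0)).Local v))) : Subgroup ((cmDatum L 2 (Matrix.of fun i j : Fin 2 => if i.val + j.val + 1 = 2 then (1 : L) else 0)).Local v × (cmDatum L 1 (Matrix.of fun i j : Fin 1 => if i.val + j.val + 1 = 1 then (1 : L) else 0)).Local v)) : Set ((cmDatum L 2 (Matrix.of fun i j : Fin 2 => if i.val + j.val + 1 = 2 then (1 : L) else 0)).Local v × (cmDatum L 1 (Matrix.of fun i j : Fin 1 => if i.val + j.val + 1 = 1 then (1 : L) else 0)).Local v))),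
        f (k⁻¹ * (((E₂.symm (uη⁻¹ ^ m), (1 : (cmDatum L 1 (Matrix.of fun i j : Fin 1 => if i.val + j.val + 1 = 1 then (1 : L) else 0)).Local v)) : ((cmDatum L 2 (Matrix.of fun i j : Fin 2 => if i.val + j.val + 1 = 2 then (1 : L) else 0)).Local v × (cmDatum L 1 (Matrix.of fun i j : Fin 1 => if i.val + j.val + 1 = 1 then (1 : L) else 0)).Local v))⁻¹ * x * (E₂.symm (uη⁻¹ ^ m), 1)) * k) ∂ν = 0 := by
  haveI := isDiscreteValuationRing_integer_of_compatible hϖF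
  have hϖ := isUniformizingElement_of_v_eq hϖF
  obtain ⟨R, hR⟩ := exists_level_le_of_isLocSmooth L v w hw hα hα0 hϖF E₂ K x₀ hx₀ hK hKo f hf
  refine ⟨R, fun m oT x s a b D hD hXm hoT hlt => ?_⟩
  refine setIntegral_eq_zero_of_forall_eq_zero fun k hk => ?_
  by_contra hne
  obtain ⟨St, hSt⟩ : ∃ St : ↥(unitaryGroupOfForm (galAdicCompletionMap (L := L) (IsCMField.complexConj L) hw) (placeForm (Matrix.of fun i j : Fin 2 => if i.val + j.val + 1 = 2 then (1 : L) else 0) w.1)), St = (uη⁻¹ ^ m)⁻¹ * E₂ x.1 * uη⁻¹ ^ m := ⟨_, rfl⟩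
  rw [← hSt] at hXm
  -- scalars
  have hϖpos : 0 < valuation (v.adicCompletion ↥(maximalRealSubfield L)) ϖF := (Valuation.pos_iff _).2 hϖ.ne_zero
  have ha0 : a ≠ 0 := by
    rintro rfl
    rw [div_zero, map_zero] at hoT
    exact pow_ne_zero oT hϖpos.ne' hoT.symm
  have hπ0 : π ≠ 0 := fun h => hϖ.ne_zero ((Valuation.zero_iff _).1 (by rw [← hπ, h, map_zero]))
  have hs : s ≠ 0 := by
    rintro rfl
    rw [zero_smul] at hXm
    have h := congrArg Matrix.det hXm
    rw [Matrix.det_mul, Matrix.det_mul, Matrix.det_zero, mul_eq_zero, mul_eq_zero] at h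
    rcases h with (h | h) | h
    · rw [Matrix.det_diagonal, Fin.prod_univ_two] at h; simp [hα0] at h
    · exact (Matrix.isUnits_det_units (St : GL (Fin 2) (w.1.adicCompletion L))).ne_zero h
    · rw [Matrix.det_diagonal, Fin.prod_univ_two] at h; simp [hα0] at h
  -- the normalised torus unit `γ₁ = (1, b₁ v₀; b₁, 1 + b₁ u₀)`, `b₁ = b ∕ a`, and the shell matrix `rm = diag(1, π^m)`
  obtain ⟨b₁, hb₁⟩ : ∃ b₁ : v.adicCompletion ↥(maximalRealSubfield L), b₁ = b / a := ⟨_, rfl⟩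
  rw [← hb₁] at hoT
  have hb₁int : b₁ ∈ 𝒪[v.adicCompletion ↥(maximalRealSubfield L)] := by
    rw [Valuation.mem_integer_iff, hoT]; exact pow_le_one₀ zero_le hϖ.valuation_le_one
  have hN1 : valuation (v.adicCompletion ↥(maximalRealSubfield L)) ((1 : v.adicCompletion ↥(maximalRealSubfield L)) ^ 2 + 1 * b₁ * u₀ - b₁ ^ 2 * v₀) = 1 := by
    rw [valuation_quadNormForm_eisenstein hϖ hu hu1 hv1, map_one, one_pow, max_eq_left]
    exact mul_le_one' (pow_le_one₀ zero_le ((Valuation.mem_integer_iff _ _).1 hb₁int)) hϖ.valuation_le_one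
  have hdet1 : (!![(1 : v.adicCompletion ↥(maximalRealSubfield L)), b₁ * v₀; b₁, 1 + b₁ * u₀]).det ≠ 0 := by
    rw [QuadraticRegularRep.det_regRep]; intro h; rw [h, map_zero] at hN1; exact zero_ne_one hN1
  obtain ⟨γ₁, hγ₁⟩ : ∃ γ₁ : GL (Fin 2) (v.adicCompletion ↥(maximalRealSubfield L)), (γ₁ : Matrix (Fin 2) (Fin 2) (v.adicCompletion ↥(maximalRealSubfield L))) = !![1, b₁ * v₀; b₁, 1 + b₁ * u₀] :=
    ⟨Matrix.GeneralLinearGroup.mk'' _ (isUnit_iff_ne_zero.2 hdet1), rfl⟩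
  have hγ₁det : valuation (v.adicCompletion ↥(maximalRealSubfield L)) (γ₁ : Matrix (Fin 2) (Fin 2) (v.adicCompletion ↥(maximalRealSubfield L))).det = 1 := by rw [hγ₁, QuadraticRegularRep.det_regRep]; exact hN1
  have hπm : (Matrix.diagonal ![(1 : v.adicCompletion ↥(maximalRealSubfield L)), π ^ m]).det ≠ 0 := by
    rw [Matrix.det_diagonal, Fin.prod_univ_two]; simp [pow_ne_zero m hπ0]
  obtain ⟨rm, hrm⟩ : ∃ rm : GL (Fin 2) (v.adicCompletion ↥(maximalRealSubfield L)), (rm : Matrix (Fin 2) (Fin 2) (v.adicCompletion ↥(maximalRealSubfield L))) = Matrix.diagonal ![1, π ^ m] :=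
    ⟨Matrix.GeneralLinearGroup.mk'' _ (isUnit_iff_ne_zero.2 hπm), rfl⟩
  have hSm : !![a, b * v₀ * π ^ m; b * (π ^ m)⁻¹, a + b * u₀] = a • ((rm⁻¹ * γ₁ * rm : GL (Fin 2) (v.adicCompletion ↥(maximalRealSubfield L))) : Matrix (Fin 2) (Fin 2) (v.adicCompletion ↥(maximalRealSubfield L))) := by
    rw [coe_inv_mul_torus_mul_of_coe_eq_diagonal u₀ v₀ 1 b₁ hγ₁ hrm (pow_ne_zero m hπ0)]
    have hab : a * b₁ = b := by rw [hb₁]; field_simp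
    ext i j
    fin_cases i <;> fin_cases j
    · simp
    · simp [← hab, mul_assoc]
    · simp [← hab, mul_assoc]
    · simp [← hab, mul_add, mul_assoc]
  -- the descent of `S̃_m` in `GL₂` form, scalar `s · ι(a)`
  have hXm' : Matrix.diagonal ![1, α] * ((St : GL (Fin 2) (w.1.adicCompletion L)) : Matrix (Fin 2) (Fin 2) (w.1.adicCompletion L)) * Matrix.diagonal ![1, α⁻¹] =
      (s * toPlace v w a) • ((D * (rm⁻¹ * γ₁ * rm) * D⁻¹ : GL (Fin 2) (v.adicCompletion ↥(maximalRealSubfield L))) : Matrix (Fin 2) (Fin 2) (v.adicCompletion ↥(maximalRealSubfield L))).map (toPlace v w) := by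
    rw [hXm, hSm]
    simp only [Units.val_mul, Matrix.mul_smul, Matrix.smul_mul]
    rw [mul_smul]
    congr 1
    ext i j
    simp only [Matrix.map_apply, Matrix.smul_apply, smul_eq_mul, map_mul]
  -- both `k.1` and `k.1⁻¹` fix the root: their descents are `e • k₀`, `k₀ ∈ GL₂(𝒪_v)`
  have hk1 : k.1 ∈ K := (Subgroup.mem_prod.1 hk).1
  obtain ⟨s₁, g₁, hs₁, hd₁⟩ := exists_descent_place L v w hw hα hα0 (E₂ k.1⁻¹)
  obtain ⟨s₂, g₂, hs₂, hd₂⟩ := exists_descent_place L v w hw hα hα0 (E₂ k.1)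
  have hg₁fix : glVertexAct hϖ g₁ x₀ = x₀ := by
    rw [← rhoVertexActPlace_eq_glVertexAct L v w hw hα hα0 hϖF (E₂ k.1⁻¹) hs₁ hd₁ x₀]; exact (hK _).1 (K.inv_mem hk1)
  have hg₂fix : glVertexAct hϖ g₂ x₀ = x₀ := by
    rw [← rhoVertexActPlace_eq_glVertexAct L v w hw hα hα0 hϖF (E₂ k.1) hs₂ hd₂ x₀]; exact (hK _).1 hk1
  have hx₀' : x₀.1 = latt ((1 : GL (Fin 2) (v.adicCompletion ↥(maximalRealSubfield L))) : Matrix (Fin 2) (Fin 2) (v.adicCompletion ↥(maximalRealSubfield L))) := by rw [Units.val_one]; exact hx₀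
  obtain ⟨e₁, k₁, hk₁, hek₁⟩ := (glVertexAct_eq_self_iff hϖ 1 x₀ hx₀' g₁).1 hg₁fix
  obtain ⟨e₂, k₂, hk₂, hek₂⟩ := (glVertexAct_eq_self_iff hϖ 1 x₀ hx₀' g₂).1 hg₂fix
  rw [inv_one, one_mul, mul_one] at hek₁ hek₂
  -- the descent of `E₂ (integrand point).1 = E₂ k.1⁻¹ · S̃_m · E₂ k.1`
  have hE₂arg : E₂ (k⁻¹ * (((E₂.symm (uη⁻¹ ^ m), (1 : (cmDatum L 1 (Matrix.of fun i j : Fin 1 => if i.val + j.val + 1 = 1 then (1 : L) else 0)).Local v)) : ((cmDatum L 2 (Matrix.of fun i j : Fin 2 => if i.val + j.val + 1 = 2 then (1 : L) else 0)).Local v × (cmDatum L 1 (Matrix.of fun i j : Fin 1 => if i.val + j.val + 1 = 1 then (1 : L) else 0)).Local v))⁻¹ * x * (E₂.symm (uη⁻¹ ^ m), 1)) * k).1 = E₂ k.1⁻¹ * (St * E₂ k.1) := by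
    rw [hSt]
    simp only [Prod.fst_mul, Prod.fst_inv, map_mul, map_inv, ContinuousMulEquiv.apply_symm_apply, mul_assoc]
  have hdesc : Matrix.diagonal ![1, α] *
      (((E₂ (k⁻¹ * (((E₂.symm (uη⁻¹ ^ m), (1 : (cmDatum L 1 (Matrix.of fun i j : Fin 1 => if i.val + j.val + 1 = 1 then (1 : L) else 0)).Local v)) : ((cmDatum L 2 (Matrix.of fun i j : Fin 2 => if i.val + j.val + 1 = 2 then (1 : L) else 0)).Local v × (cmDatum L 1 (Matrix.of fun i j : Fin 1 => if i.val + j.val + 1 = 1 then (1 : L) else 0)).Local v))⁻¹ * x * (E₂.symm (uη⁻¹ ^ m), 1)) * k).1 : ↥(unitaryGroupOfForm (galAdicCompletionMap (L := L) (IsCMField.complexConj L) hw) (placeForm (Matrix.of fun i j : Fin 2 => if i.val + j.val + 1 = 2 then (1 : L) else 0) w.1))) : GL (Fin 2) (w.1.adicCompletion L)) : Matrix (Fin 2) (Fin 2) (w.1.adicCompletion L)) *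
      Matrix.diagonal ![1, α⁻¹] =
      (s₁ * ((s * toPlace v w a) * s₂)) • ((g₁ * ((D * (rm⁻¹ * γ₁ * rm) * D⁻¹) * g₂) : GL (Fin 2) (v.adicCompletion ↥(maximalRealSubfield L))) : Matrix (Fin 2) (Fin 2) (v.adicCompletion ↥(maximalRealSubfield L))).map (toPlace v w) := by
    rw [hE₂arg, Subgroup.coe_mul, Subgroup.coe_mul]
    exact descent_mul (toPlace v w) hα0 hd₁ (descent_mul (toPlace v w) hα0 hXm' hd₂)
  -- the level of that vertex is `≤ R` (support radius) …
  obtain ⟨n, c'', g₀, hc'', hG, hint, hprim, hdet⟩ := exists_level hϖ (g₁ * ((D * (rm⁻¹ * γ₁ * rm) * D⁻¹) * g₂))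
  have hsc : s₁ * ((s * toPlace v w a) * s₂) ≠ 0 := mul_ne_zero hs₁ (mul_ne_zero (mul_ne_zero hs ((map_ne_zero _).2 ha0)) hs₂)
  have hnle : n ≤ R := hR _ hne hsc hdesc hc'' hG hint hprim hdet
  -- … and `> R` (the shell conjugate, after stripping the scalars `e₁ e₂`)
  have hGcoe : ((g₁ * ((D * (rm⁻¹ * γ₁ * rm) * D⁻¹) * g₂) : GL (Fin 2) (v.adicCompletion ↥(maximalRealSubfield L))) : Matrix (Fin 2) (Fin 2) (v.adicCompletion ↥(maximalRealSubfield L))) =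
      ((e₁ : v.adicCompletion ↥(maximalRealSubfield L)) * e₂) • (((k₁ * D) * (rm⁻¹ * γ₁ * rm) * (D⁻¹ * k₂) : GL (Fin 2) (v.adicCompletion ↥(maximalRealSubfield L))) : Matrix (Fin 2) (Fin 2) (v.adicCompletion ↥(maximalRealSubfield L))) := by
    rw [hek₁, hek₂]
    simp only [Units.val_mul, HermitianLatticeTree.coe_units_map_scalar, Matrix.smul_mul, Matrix.mul_smul, Matrix.one_mul, Matrix.mul_assoc, smul_smul, mul_comm (e₂ : v.adicCompletion ↥(maximalRealSubfield L)) (e₁ : v.adicCompletion ↥(maximalRealSubfield L))]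
  have hS : (((k₁ * D) * (rm⁻¹ * γ₁ * rm) * (D⁻¹ * k₂) : GL (Fin 2) (v.adicCompletion ↥(maximalRealSubfield L))) : Matrix (Fin 2) (Fin 2) (v.adicCompletion ↥(maximalRealSubfield L))) = (((e₁ : v.adicCompletion ↥(maximalRealSubfield L)) * e₂)⁻¹ * c'') • g₀ := by
    rw [mul_smul, ← hG, hGcoe, smul_smul, inv_mul_cancel₀ (mul_ne_zero e₁.ne_zero e₂.ne_zero), one_smul]
  have hoT' : valuation (v.adicCompletion ↥(maximalRealSubfield L)) b₁ = valuation (v.adicCompletion ↥(maximalRealSubfield L)) ϖF ^ oT := hoT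
  have hlt' : R < n :=
    level_gt_of_glInt_mul_shellConj_mul_glInt hϖ hu1 hv1 (one_mem _) hb₁int hoT' hγ₁ hγ₁det hπ hrm hlt (mul_mem hk₁ hD) (mul_mem (inv_mem hD) hk₂)
      (mul_ne_zero (inv_ne_zero (mul_ne_zero e₁.ne_zero e₂.ne_zero)) hc'') hS hint hprim hdet
  exact absurd hnle (not_le.2 hlt')

/-- **(V-top), B-p14 (g33)'s `hXm` SHAPE** (`D = 1`): the shell hypothesis exactly as produced by ★ `descent_shellConjugate_regRep` —
`diag(1,α) ↑↑((uη⁻¹ ^ m)⁻¹ * E₂ x.1 * uη⁻¹ ^ m) diag(1,α)⁻¹ = s • (a, b v₀ π^m; b π^{−m}, a + b u₀).map ι`; conclusion `fbar m x = 0` for `oT + R < m`.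
[cite: LabesseLanglands1979, §2 (2.1) p. 8] [cite: Serre1980Trees, Ch. II §1.1, §1.3] -/
theorem exists_setIntegral_shellConj_eq_zero_of_lt' [MeasurableSpace ((cmDatum L 2 (Matrix.of fun i j : Fin 2 => if i.val + j.val + 1 = 2 then (1 : L) else 0)).Local v × (cmDatum L 1 (Matrix.of fun i j : Fin 1 => if i.val + j.val + 1 = 1 then (1 : L) else 0)).Local v)] (ν : Measure ((cmDatum L 2 (Matrix.of fun i j : Fin 2 => if i.val + j.val + 1 = 2 then (1 : L) else 0)).Local v × (cmDatum L 1 (Matrix.of fun i j : Fin 1 => if i.val + j.val + 1 = 1 then (1 : L) else 0)).Local v))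
    (E₂ : (cmDatum L 2 (Matrix.of fun i j : Fin 2 => if i.val + j.val + 1 = 2 then (1 : L) else 0)).Local v ≃ₜ* ↥(unitaryGroupOfForm (galAdicCompletionMap (L := L) (IsCMField.complexConj L) hw) (placeForm (Matrix.of fun i j : Fin 2 => if i.val + j.val + 1 = 2 then (1 : L) else 0) w.1))) (K : Subgroup ((cmDatum L 2 (Matrix.of fun i j : Fin 2 => if i.val + j.val + 1 = 2 then (1 : L) else 0)).Local v)) (x₀ : {M : Submodule 𝒪[v.adicCompletion ↥(maximalRealSubfield L)] (Fin 2 → v.adicCompletion ↥(maximalRealSubfield L)) // IsSpecialLattice (RingHom.id _) ϖF !![(0 : v.adicCompletion ↥(maximalRealSubfield L)), 1; -1, 0] M}) (hx₀ : x₀.1 = latt (1 : Matrix (Fin 2) (Fin 2) (v.adicCompletion ↥(maximalRealSubfield L))))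
    (hK : ∀ g, g ∈ K ↔ rhoVertexActPlace L v w hw hα hα0 hϖF (E₂ g) x₀ = x₀)
    (hKo : IsOpen (((K.prod (⊤ : Subgroup ((cmDatum L 1 (Matrix.of fun i j : Fin 1 => if i.val + j.val + 1 = 1 then (1 : L) else 0)).Local v))) : Subgroup ((cmDatum L 2 (Matrix.of fun i j : Fin 2 => if i.val + j.val + 1 = 2 then (1 : L) else 0)).Local v × (cmDatum L 1 (Matrix.of fun i j : Fin 1 => if i.val + j.val + 1 = 1 then (1 : L) else 0)).Local v)) : Set ((cmDatum L 2 (Matrix.of fun i j : Fin 2 => if i.val + j.val + 1 = 2 then (1 : L) else 0)).Local v × (cmDatum L 1 (Matrix.of fun i j : Fin 1 => if i.val + j.val + 1 = 1 then (1 : L) else 0)).Local v)))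
    (f : ((cmDatum L 2 (Matrix.of fun i j : Fin 2 => if i.val + j.val + 1 = 2 then (1 : L) else 0)).Local v × (cmDatum L 1 (Matrix.of fun i j : Fin 1 => if i.val + j.val + 1 = 1 then (1 : L) else 0)).Local v) → ℂ) (hf : IsLocSmooth f)
    {u₀ v₀ : v.adicCompletion ↥(maximalRealSubfield L)} (hu : u₀ ∈ 𝒪[v.adicCompletion ↥(maximalRealSubfield L)]) (hu1 : valuation (v.adicCompletion ↥(maximalRealSubfield L)) u₀ < 1) (hv1 : valuation (v.adicCompletion ↥(maximalRealSubfield L)) v₀ = valuation (v.adicCompletion ↥(maximalRealSubfield L)) ϖF)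
    {π : v.adicCompletion ↥(maximalRealSubfield L)} (hπ : valuation (v.adicCompletion ↥(maximalRealSubfield L)) π = valuation (v.adicCompletion ↥(maximalRealSubfield L)) ϖF) (uη : ↥(unitaryGroupOfForm (galAdicCompletionMap (L := L) (IsCMField.complexConj L) hw) (placeForm (Matrix.of fun i j : Fin 2 => if i.val + j.val + 1 = 2 then (1 : L) else 0) w.1))) :
    ∃ R : ℕ, ∀ (m oT : ℕ) (x : ((cmDatum L 2 (Matrix.of fun i j : Fin 2 => if i.val + j.val + 1 = 2 then (1 : L) else 0)).Local v × (cmDatum L 1 (Matrix.of fun i j : Fin 1 => if i.val + j.val + 1 = 1 then (1 : L) else 0)).Local v)) {s : w.1.adicCompletion L} {a b : v.adicCompletion ↥(maximalRealSubfield L)},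
      Matrix.diagonal ![1, α] * ((((uη⁻¹ ^ m)⁻¹ * E₂ x.1 * uη⁻¹ ^ m : ↥(unitaryGroupOfForm (galAdicCompletionMap (L := L) (IsCMField.complexConj L) hw) (placeForm (Matrix.of fun i j : Fin 2 => if i.val + j.val + 1 = 2 then (1 : L) else 0) w.1))) : GL (Fin 2) (w.1.adicCompletion L)) : Matrix (Fin 2) (Fin 2) (w.1.adicCompletion L)) * Matrix.diagonal ![1, α⁻¹] =
        s • (!![a, b * v₀ * π ^ m; b * (π ^ m)⁻¹, a + b * u₀]).map (toPlace v w) →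
      valuation (v.adicCompletion ↥(maximalRealSubfield L)) (b / a) = valuation (v.adicCompletion ↥(maximalRealSubfield L)) ϖF ^ oT → oT + R < m →
      ∫ k in ((((K.prod (⊤ : Subgroup ((cmDatum L 1 (Matrix.of fun i j : Fin 1 => if i.val + j.val + 1 = 1 then (1 : L) else 0)).Local v))) : Subgroup ((cmDatum L 2 (Matrix.of fun i j : Fin 2 => if i.val + j.val + 1 = 2 then (1 : L) else 0)).Local v × (cmDatum L 1 (Matrix.of fun i j : Fin 1 => if i.val + j.val + 1 = 1 then (1 : L) else 0)).Local v)) : Set ((cmDatum L 2 (Matrix.of fun i j : Fin 2 => if i.val + j.val + 1 = 2 then (1 : L) else 0)).Local v × (cmDatum L 1 (Matrix.of fun i j : Fin 1 => if i.val + j.val + 1 = 1 then (1 : L) else 0)).Local v))),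
        f (k⁻¹ * (((E₂.symm (uη⁻¹ ^ m), (1 : (cmDatum L 1 (Matrix.of fun i j : Fin 1 => if i.val + j.val + 1 = 1 then (1 : L) else 0)).Local v)) : ((cmDatum L 2 (Matrix.of fun i j : Fin 2 => if i.val + j.val + 1 = 2 then (1 : L) else 0)).Local v × (cmDatum L 1 (Matrix.of fun i j : Fin 1 => if i.val + j.val + 1 = 1 then (1 : L) else 0)).Local v))⁻¹ * x * (E₂.symm (uη⁻¹ ^ m), 1)) * k) ∂ν = 0 := by
  obtain ⟨R, hR⟩ := exists_setIntegral_shellConj_eq_zero_of_lt L v w hw hα hα0 hϖF ν E₂ K x₀ hx₀ hK hKo f hf hu hu1 hv1 hπ uη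
  refine ⟨R, fun m oT x s a b hXm hoT hlt => hR m oT x (s := s) (D := 1) (one_mem _) ?_ hoT hlt⟩
  rw [inv_one, Units.val_one, Matrix.one_mul, Matrix.mul_one]
  exact hXm

end Place

end Literature.NumberTheory.Rogawski1990

end
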